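import Summits.AnomalousDissipation.AnomalousDissipation.Theses.MomentParity
import Summits.AnomalousDissipation.AnomalousDissipation.Theorems.QuarticGate.Negative.EnergyRow
import Summits.AnomalousDissipation.AnomalousDissipation.Theorems.MomentLadder.Negative.EnergyRow
import Summits.AnomalousDissipation.AnomalousDissipation.Theorems.MomentParityMomentClosureCarrier
import Summits.AnomalousDissipation.AnomalousDissipation.Theorems.MomentParityUniformResolutionNecessity
import Summits.AnomalousDissipation.AnomalousDissipation.Theorems.MomentParityResolvedDissipationConverse
import Literature.Analysis.FluidPDE.StatisticalSolutionEnergyEq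
import Literature.Analysis.FluidPDE.EnergySpaceRellich
import Literature.Analysis.FluidPDE.DissipationAnomalyProofs
import Mathlib.MeasureTheory.Measure.Prokhorov
import Mathlib.MeasureTheory.Measure.LevyProkhorovMetric
import Mathlib.MeasureTheory.Measure.Portmanteau
import Mathlib.MeasureTheory.Integral.Layercake

/-!
# Stub `stub_tightExtraction` (K2a) for line `lions-l4-domination`
# (crux `MomentParity.ResolvedDissipation`, stmt-AnomalousDissipation-14284)

Rellich–Prokhorov extraction on the energy space `H = L²_σ(T³)` (pure measure theory, no dynamics).
A sequence of Borel probability laws `μ_i` on `H` carried by the closed ball `‖u‖ ≤ R` with uniformly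
bounded mean enstrophy `∫ ‖∇u‖² dμ_i ≤ M` is TIGHT IN THE NORM TOPOLOGY of `H`: Markov gives
`μ_i {‖∇u‖² ≥ L} ≤ M / L` and the enstrophy balls `{‖∇u‖² ≤ L}` are norm-compact (Rellich,
`Torus.isCompact_setOf_eGradNormSq_le`). By Prokhorov (Mathlib `isCompact_closure_of_isTightMeasureSet`)
and the Lévy–Prokhorov metrisability of `ProbabilityMeasure H` (`H` is a separable metric space) a
subsequence converges weakly to a probability law `μ_∞`; the portmanteau theorem then gives

* `μ_∞` is carried by the closed ball (its complement is open and `μ_i`-null);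
* convergence of `∫ g dμ` for bounded continuous real `g`;
* `∫ G dμ_∞ ≤ liminf ∫ G dμ_{φ i}` for every lower semicontinuous `G : H → [0, ∞]`
  (`lintegral_le_liminf_lintegral_of_lowerSemicontinuous`: truncate at height `n`, layer-cake formula
  `∫ G ∧ n = ∫₀^∞ μ{t < G ∧ n} dt` with OPEN superlevel sets, open-set portmanteau, Fatou in `t`,
  monotone convergence in `n`);
* convergence of `∫ g dμ` for every continuous `g` bounded on the ball (clip `g` to a bounded continuous
  function, equal to `g` almost everywhere under every measure involved), whence convergence of the
  truncated enstrophies `∫ ‖∇P_K u‖² dμ` (a continuous band sum, `≤ 4π²K²R²` on the ball by Bernstein)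
  and of the pairings `∫ (u, f) dμ`, `f ∈ L²` (`|(u,f)| ≤ ‖u‖‖f‖₂`).

References: Billingsley, *Convergence of Probability Measures*, Thms 2.1 (portmanteau), 5.1 (Prokhorov);
Foias–Manley–Rosa–Temam 2001, Ch. II §6 (Rellich), Ch. IV §1 (measures on `H`).
-/

noncomputable section

-- `Summit.<Summit>.<Problem>`: single-conjunct summit, the duplicate namespace segment is mandated.
set_option linter.dupNamespace false

namespace Summit.AnomalousDissipation.AnomalousDissipation.Theorems.MomentParityResolvedDissipation.TightExtraction

open MeasureTheory Filter Topology
open scoped ENNReal NNReal InnerProductSpace RealInnerProductSpace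
open Literature.Analysis.FunctionSpaces Literature.Analysis.FluidPDE
open Summit.AnomalousDissipation.AnomalousDissipation.Theses.MomentParity
open Summit.AnomalousDissipation.AnomalousDissipation.Theorems.QuarticGate.Negative

/-! ## Portmanteau for lower semicontinuous `[0, ∞]`-valued functionals -/

section Portmanteau

variable {Ω : Type*} [MeasurableSpace Ω] [TopologicalSpace Ω]

/-- **Layer-cake Fatou.** If every open set satisfies `μ U ≤ liminf μ_i U` and `g ≥ 0` is a measurable
real function all of whose strict superlevel sets `{t < g}` are open (e.g. `g` lower semicontinuous),
then `∫ g dμ ≤ liminf ∫ g dμ_i` (as lower Lebesgue integrals of `ofReal ∘ g`): layer cake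
`∫ g = ∫₀^∞ μ{t < g} dt` and Fatou in `t` (the proof of Mathlib's
`lintegral_le_liminf_lintegral_of_forall_isOpen_measure_le_liminf_measure`, which assumes `g` continuous,
verbatim). [folklore] -/
theorem lintegral_ofReal_le_liminf_of_isOpen_lt {μ : Measure Ω} {μs : ℕ → Measure Ω} {g : Ω → ℝ}
    (g_mble : Measurable g) (g_nn : 0 ≤ g) (hg : ∀ t : ℝ, IsOpen {a | t < g a})
    (h_opens : ∀ U, IsOpen U → μ U ≤ atTop.liminf (fun i => μs i U)) :
    ∫⁻ x, ENNReal.ofReal (g x) ∂μ ≤ atTop.liminf (fun i => ∫⁻ x, ENNReal.ofReal (g x) ∂(μs i)) := by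
  simp_rw [lintegral_eq_lintegral_meas_lt _ (Eventually.of_forall g_nn) g_mble.aemeasurable]
  calc ∫⁻ (t : ℝ) in Set.Ioi 0, μ {a | t < g a}
      ≤ ∫⁻ (t : ℝ) in Set.Ioi 0, atTop.liminf (fun i => (μs i) {a | t < g a}) :=
        lintegral_mono fun t => h_opens _ (hg t)
    _ ≤ atTop.liminf (fun i => ∫⁻ (t : ℝ) in Set.Ioi 0, (μs i) {a | t < g a}) :=
        lintegral_liminf_le fun n => Antitone.measurable fun s t hst =>
          measure_mono fun ω hω => lt_of_le_of_lt hst hω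

/-- **lsc portmanteau in `[0, ∞]`.** If every open set satisfies `μ U ≤ liminf μ_i U` (e.g. `μ_i ⇀ μ`
weakly, probability measures), then `∫ G dμ ≤ liminf ∫ G dμ_i` for every lower semicontinuous
`G : Ω → [0, ∞]` (possibly `= ∞` somewhere): apply `lintegral_ofReal_le_liminf_of_isOpen_lt` to the
truncations `(G ∧ n).toReal`, whose strict superlevel sets `{ofReal t < G} ∩ {ofReal t < n}` are open,
and let `n → ∞` by monotone convergence (Billingsley, Convergence of Probability Measures, Thm 2.1 and
Problem 2.6). [folklore] -/
theorem lintegral_le_liminf_lintegral_of_lowerSemicontinuous [OpensMeasurableSpace Ω]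
    {μ : Measure Ω} {μs : ℕ → Measure Ω} {G : Ω → ℝ≥0∞} (hG : LowerSemicontinuous G)
    (h_opens : ∀ U, IsOpen U → μ U ≤ atTop.liminf (fun i => μs i U)) :
    ∫⁻ x, G x ∂μ ≤ atTop.liminf (fun i => ∫⁻ x, G x ∂(μs i)) := by
  have hGm : Measurable G := hG.measurable
  -- truncations at height `n`
  have key : ∀ n : ℕ, ∫⁻ x, G x ⊓ (n : ℝ≥0∞) ∂μ ≤ atTop.liminf (fun i => ∫⁻ x, G x ∂(μs i)) := by
    intro n
    have hne : ∀ x, G x ⊓ (n : ℝ≥0∞) ≠ ⊤ := fun x =>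
      ne_top_of_le_ne_top (ENNReal.natCast_ne_top n) inf_le_right
    set g : Ω → ℝ := fun x => (G x ⊓ (n : ℝ≥0∞)).toReal with hg_def
    have hg_eq : ∀ x, ENNReal.ofReal (g x) = G x ⊓ (n : ℝ≥0∞) := fun x =>
      ENNReal.ofReal_toReal (hne x)
    have g_nn : 0 ≤ g := fun x => ENNReal.toReal_nonneg
    have g_mble : Measurable g := (hGm.min measurable_const).ennreal_toReal
    have hopen : ∀ t : ℝ, IsOpen {a | t < g a} := by
      intro t
      by_cases ht : t < 0
      · convert isOpen_univ
        exact Set.eq_univ_of_forall fun a => ht.trans_le (g_nn a)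
      · push Not at ht
        have hset : {a | t < g a} =
            G ⁻¹' Set.Ioi (ENNReal.ofReal t) ∩ {_a | ENNReal.ofReal t < (n : ℝ≥0∞)} := by
          ext a
          simp only [Set.mem_setOf_eq, Set.mem_inter_iff, Set.mem_preimage, Set.mem_Ioi]
          rw [hg_def, ← ENNReal.ofReal_lt_iff_lt_toReal ht (hne a), lt_inf_iff]
        rw [hset]
        exact (hG.isOpen_preimage _).inter isOpen_const
    calc ∫⁻ x, G x ⊓ (n : ℝ≥0∞) ∂μ = ∫⁻ x, ENNReal.ofReal (g x) ∂μ := by simp_rw [hg_eq]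
      _ ≤ atTop.liminf (fun i => ∫⁻ x, ENNReal.ofReal (g x) ∂(μs i)) :=
          lintegral_ofReal_le_liminf_of_isOpen_lt g_mble g_nn hopen h_opens
      _ = atTop.liminf (fun i => ∫⁻ x, G x ⊓ (n : ℝ≥0∞) ∂(μs i)) := by simp_rw [hg_eq]
      _ ≤ atTop.liminf (fun i => ∫⁻ x, G x ∂(μs i)) :=
          liminf_le_liminf (Eventually.of_forall fun i => lintegral_mono fun x => inf_le_left)
  have hsup : ∀ x, ⨆ n : ℕ, G x ⊓ (n : ℝ≥0∞) = G x := fun x => by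
    rw [← inf_iSup_eq, ENNReal.iSup_natCast, inf_top_eq]
  calc ∫⁻ x, G x ∂μ = ∫⁻ x, ⨆ n : ℕ, G x ⊓ (n : ℝ≥0∞) ∂μ := by simp_rw [hsup]
    _ = ⨆ n : ℕ, ∫⁻ x, G x ⊓ (n : ℝ≥0∞) ∂μ :=
        lintegral_iSup (fun n => hGm.min measurable_const) fun m n hmn x =>
          inf_le_inf le_rfl (by exact_mod_cast hmn)
    _ ≤ atTop.liminf (fun i => ∫⁻ x, G x ∂(μs i)) := iSup_le key

end Portmanteau

/-! ## Continuous functions bounded on a carrier of full measure -/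

section Clip

variable {Ω : Type*} [MeasurableSpace Ω] [TopologicalSpace Ω]

/-- **Clipping.** If `∫ g dμ_i → ∫ g dμ` for all bounded continuous real `g`, and `S` is a set of full
measure for `μ` and every `μ_i`, then `∫ g dμ_i → ∫ g dμ` for every continuous `g` bounded ON `S`:
`g` agrees almost everywhere (under all these measures) with its clipping `max (-B) (min B g)`, which is
bounded and continuous. [folklore] -/
theorem tendsto_integral_of_forall_bounded_continuous {μ : Measure Ω} {μs : ℕ → Measure Ω}
    (hBC : ∀ g : Ω → ℝ, Continuous g → (∃ B : ℝ, ∀ u, |g u| ≤ B) →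
      Tendsto (fun i => ∫ u, g u ∂(μs i)) atTop (𝓝 (∫ u, g u ∂μ)))
    {S : Set Ω} (hS : ∀ᵐ u ∂μ, u ∈ S) (hSi : ∀ i, ∀ᵐ u ∂(μs i), u ∈ S)
    {g : Ω → ℝ} (hg : Continuous g) {B : ℝ} (hB : ∀ u ∈ S, |g u| ≤ B) :
    Tendsto (fun i => ∫ u, g u ∂(μs i)) atTop (𝓝 (∫ u, g u ∂μ)) := by
  -- the clipped function
  set g' : Ω → ℝ := fun u => max (-B) (min B (g u)) with hg'_def
  have hg' : Continuous g' := continuous_const.max (continuous_const.min hg)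
  have hg'B : ∀ u, |g' u| ≤ |B| := fun u => by
    rw [abs_le]
    refine ⟨(neg_le_neg (le_abs_self B)).trans (le_max_left _ _), max_le ?_ ?_⟩
    · exact neg_le_abs B
    · exact (min_le_left _ _).trans (le_abs_self B)
  have heq : ∀ u ∈ S, g' u = g u := fun u hu => by
    have h := abs_le.1 (hB u hu)
    rw [hg'_def]
    simp only [min_eq_right h.2, max_eq_right h.1]
  have h1 : (fun i => ∫ u, g u ∂(μs i)) = fun i => ∫ u, g' u ∂(μs i) := funext fun i =>
    integral_congr_ae ((hSi i).mono fun u hu => (heq u hu).symm)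
  have h2 : ∫ u, g u ∂μ = ∫ u, g' u ∂μ := integral_congr_ae (hS.mono fun u hu => (heq u hu).symm)
  rw [h1, h2]
  exact hBC g' hg' ⟨|B|, hg'B⟩

end Clip

/-! ## The extraction -/

/-- **K2a `stub_tightExtraction` — Rellich–Prokhorov extraction on `H = L²_σ(T³)`** (registered stub of
line `lions-l4-domination`; pure measure theory). A sequence of Borel probability laws on `H` supported
in the ball `‖u‖ ≤ R` with uniformly bounded mean enstrophy `∫‖∇u‖² dμ_i ≤ M` is tight in the NORM
topology of `H` (Markov + Rellich `Torus.isCompact_setOf_eGradNormSq_le`), hence (Prokhorov,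
`isCompact_closure_of_isTightMeasureSet`; `ProbabilityMeasure H` is metrisable by Lévy–Prokhorov since
`H` is a separable metric space) has a subsequence converging weakly to a probability law `μ_∞`, again
carried by the closed ball (open-set portmanteau), with: convergence of `∫ g` for bounded continuous
`g : H → ℝ`; the lsc portmanteau `∫ G dμ_∞ ≤ liminf ∫ G dμ_{φ i}` for lower semicontinuous
`G : H → [0,∞]` (`lintegral_le_liminf_lintegral_of_lowerSemicontinuous`); convergence of every truncated
enstrophy `∫ ‖∇P_K u‖² dμ` (`u ↦ ‖∇P_K u‖²` is a continuous band sum, `≤ 4π²K²R²` on the ball) and of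
every pairing `∫ (u, f) dμ`, `f ∈ L²` (`Torus.continuous_pairing_coe`, `|(u,f)| ≤ ‖f‖₂R` on the ball),
both by clipping (`tendsto_integral_of_forall_bounded_continuous`). Billingsley, Convergence of
Probability Measures, Thms 2.1, 5.1; FMRT 2001, Ch. II §6, Ch. IV §1. [folklore] -/
theorem stub_tightExtraction :
    ∀ (R : ℝ) (M : ℝ≥0) (μ : ℕ → Measure (Torus.energySpace (Fin 3))),
      (∀ i, IsProbabilityMeasure (μ i)) → (∀ i, ∀ᵐ u ∂(μ i), ‖u‖ ≤ R) →
      (∀ i, Torus.ensembleEnstrophy (μ i) ≤ M) →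
      ∃ φ : ℕ → ℕ, StrictMono φ ∧ ∃ μlim : Measure (Torus.energySpace (Fin 3)),
        IsProbabilityMeasure μlim ∧ (∀ᵐ u ∂μlim, ‖u‖ ≤ R) ∧
        (∀ g : Torus.energySpace (Fin 3) → ℝ, Continuous g → (∃ B : ℝ, ∀ u, |g u| ≤ B) →
          Tendsto (fun i => ∫ u, g u ∂(μ (φ i))) atTop (𝓝 (∫ u, g u ∂μlim))) ∧
        (∀ G : Torus.energySpace (Fin 3) → ℝ≥0∞, LowerSemicontinuous G →
          ∫⁻ u, G u ∂μlim ≤ Filter.liminf (fun i => ∫⁻ u, G u ∂(μ (φ i))) atTop) ∧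
        (∀ K : ℕ, Tendsto (fun i => ∫⁻ u, Torus.eGradNormSq (Torus.fourierTruncate K
            (u.1 : UnitAddTorus (Fin 3) → EuclideanSpace ℝ (Fin 3))) ∂(μ (φ i))) atTop
          (𝓝 (∫⁻ u, Torus.eGradNormSq (Torus.fourierTruncate K
            (u.1 : UnitAddTorus (Fin 3) → EuclideanSpace ℝ (Fin 3))) ∂μlim))) ∧
        (∀ f : UnitAddTorus (Fin 3) → EuclideanSpace ℝ (Fin 3), MemLp f 2 volume →
          Tendsto (fun i => ∫ u, Torus.pairing u.1 f ∂(μ (φ i))) atTop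
            (𝓝 (∫ u, Torus.pairing u.1 f ∂μlim))) := by
  intro R M μ hp hb hM
  -- the enstrophy functional on `H` and its measurability
  let eG : Torus.energySpace (Fin 3) → ℝ≥0∞ := fun u =>
    Torus.eGradNormSq (u.1 : UnitAddTorus (Fin 3) → EuclideanSpace ℝ (Fin 3))
  have heG : Measurable eG := Torus.measurable_eGradNormSq_coe
  -- the laws as probability measures
  let P : ℕ → ProbabilityMeasure (Torus.energySpace (Fin 3)) := fun n => ⟨μ n, hp n⟩
  -- Step 1: tightness in the norm topology (Markov + Rellich)
  have htight : IsTightMeasureSet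
      {((Q : ProbabilityMeasure (Torus.energySpace (Fin 3))) : Measure (Torus.energySpace (Fin 3))) |
        Q ∈ Set.range P} := by
    rw [isTightMeasureSet_iff_exists_isCompact_measure_compl_le]
    intro ε hε
    by_cases hεtop : ε = ⊤
    · exact ⟨∅, isCompact_empty, fun _ _ => hεtop ▸ le_top⟩
    set L : ℝ≥0∞ := (M : ℝ≥0∞) / ε + 1 with hL
    have hLtop : L ≠ ⊤ :=
      ENNReal.add_ne_top.2 ⟨ENNReal.div_ne_top ENNReal.coe_ne_top hε.ne', ENNReal.one_ne_top⟩
    have hL0 : L ≠ 0 := ne_of_gt (lt_of_lt_of_le zero_lt_one le_add_self)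
    refine ⟨{u | eG u ≤ L}, Torus.isCompact_setOf_eGradNormSq_le hLtop, ?_⟩
    rintro _ ⟨Q, ⟨n, rfl⟩, rfl⟩
    change μ n {u | eG u ≤ L}ᶜ ≤ ε
    calc μ n {u | eG u ≤ L}ᶜ ≤ μ n {u | L ≤ eG u} := measure_mono fun u hu => by
            simp only [Set.mem_compl_iff, Set.mem_setOf_eq, not_le] at hu ⊢
            exact hu.le
      _ ≤ (∫⁻ u, eG u ∂(μ n)) / L := meas_ge_le_lintegral_div heG.aemeasurable hL0 hLtop
      _ ≤ (M : ℝ≥0∞) / L := by gcongr; exact hM n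
      _ ≤ ε := by
          rw [ENNReal.div_le_iff_le_mul (Or.inl hL0) (Or.inl hLtop), hL, mul_add, mul_one,
            ENNReal.mul_div_cancel hε.ne' hεtop]
          exact le_self_add
  -- Step 2: Prokhorov and Lévy–Prokhorov metrisability give a weakly convergent subsequence
  obtain ⟨Q, -, φ, hφ, hQ⟩ := (isCompact_closure_of_isTightMeasureSet htight).tendsto_subseq
    (x := P) fun n => subset_closure (Set.mem_range_self n)
  -- Step 3: the portmanteau consequences
  have hopen : ∀ U : Set (Torus.energySpace (Fin 3)), IsOpen U →
      (Q : Measure (Torus.energySpace (Fin 3))) U ≤ atTop.liminf (fun i => μ (φ i) U) :=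
    fun U hU => ProbabilityMeasure.le_liminf_measure_open_of_tendsto hQ hU
  have hBC : ∀ g : Torus.energySpace (Fin 3) → ℝ, Continuous g → (∃ B : ℝ, ∀ u, |g u| ≤ B) →
      Tendsto (fun i => ∫ u, g u ∂(μ (φ i))) atTop
        (𝓝 (∫ u, g u ∂(Q : Measure (Torus.energySpace (Fin 3))))) := by
    rintro g hg ⟨B, hB⟩
    exact (ProbabilityMeasure.tendsto_iff_forall_integral_tendsto.1 hQ)
      (BoundedContinuousFunction.ofNormedAddCommGroup g hg B fun u => by
        rw [Real.norm_eq_abs]; exact hB u)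
  have hball : ∀ᵐ u ∂(Q : Measure (Torus.energySpace (Fin 3))), ‖u‖ ≤ R := by
    have hU : IsOpen {u : Torus.energySpace (Fin 3) | ¬‖u‖ ≤ R} := by
      rw [← Set.compl_setOf]
      exact (isClosed_le continuous_norm continuous_const).isOpen_compl
    have h0 : ∀ i, μ (φ i) {u | ¬‖u‖ ≤ R} = 0 := fun i => ae_iff.1 (hb (φ i))
    have hQ0 : (Q : Measure (Torus.energySpace (Fin 3))) {u | ¬‖u‖ ≤ R} = 0 := by
      refine le_antisymm ((hopen _ hU).trans ?_) bot_le
      simp only [h0, liminf_const, le_refl]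
    exact ae_iff.2 hQ0
  have hLSC : ∀ G : Torus.energySpace (Fin 3) → ℝ≥0∞, LowerSemicontinuous G →
      ∫⁻ u, G u ∂(Q : Measure (Torus.energySpace (Fin 3))) ≤
        Filter.liminf (fun i => ∫⁻ u, G u ∂(μ (φ i))) atTop :=
    fun G hG => lintegral_le_liminf_lintegral_of_lowerSemicontinuous hG hopen
  -- continuous functions bounded on the ball
  have hballC : ∀ g : Torus.energySpace (Fin 3) → ℝ, Continuous g → ∀ B : ℝ,
      (∀ u : Torus.energySpace (Fin 3), ‖u‖ ≤ R → |g u| ≤ B) →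
      Tendsto (fun i => ∫ u, g u ∂(μ (φ i))) atTop
        (𝓝 (∫ u, g u ∂(Q : Measure (Torus.energySpace (Fin 3))))) :=
    fun g hg B hB => tendsto_integral_of_forall_bounded_continuous hBC
      (S := {u | ‖u‖ ≤ R}) hball (fun i => hb (φ i)) hg (fun u hu => hB u hu)
  -- truncated enstrophies
  have hTE : ∀ K : ℕ, Tendsto (fun i => ∫⁻ u, Torus.eGradNormSq (Torus.fourierTruncate K
      (u.1 : UnitAddTorus (Fin 3) → EuclideanSpace ℝ (Fin 3))) ∂(μ (φ i))) atTop
      (𝓝 (∫⁻ u, Torus.eGradNormSq (Torus.fourierTruncate K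
        (u.1 : UnitAddTorus (Fin 3) → EuclideanSpace ℝ (Fin 3)))
          ∂(Q : Measure (Torus.energySpace (Fin 3))))) := by
    intro K
    -- the truncated enstrophy is `ofReal` of a continuous nonnegative band sum ...
    let band : Torus.energySpace (Fin 3) → ℝ := fun u => 4 * Real.pi ^ 2 * ∑ k ∈ Torus.freqBall K,
      Torus.freqNormSq k * ‖UnitAddTorus.mFourierCoeff (EuclideanSpace.complexify ∘
        (u.1 : UnitAddTorus (Fin 3) → EuclideanSpace ℝ (Fin 3))) k‖ ^ 2
    have hband : ∀ u : Torus.energySpace (Fin 3), Torus.eGradNormSq (Torus.fourierTruncate K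
        (u.1 : UnitAddTorus (Fin 3) → EuclideanSpace ℝ (Fin 3))) = ENNReal.ofReal (band u) :=
      MomentParityMomentClosure.eGradNormSq_fourierTruncate_coe K
    have hcont : Continuous band := MomentParityMomentClosure.continuous_bandEnstrophy _
    have hnn : ∀ u, 0 ≤ band u := MomentParityMomentClosure.bandEnstrophy_nonneg _
    -- ... bounded by `4π²K²R²` on the ball (Bernstein)
    have hbd : ∀ u : Torus.energySpace (Fin 3), ‖u‖ ≤ R →
        |band u| ≤ 4 * Real.pi ^ 2 * (K : ℝ) ^ 2 * R ^ 2 := by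
      intro u hu
      rw [abs_of_nonneg (hnn u)]
      have h1 : ENNReal.ofReal (band u) ≤ ENNReal.ofReal (4 * Real.pi ^ 2 * (K : ℝ) ^ 2 * ‖u‖ ^ 2) :=
        (hband u).symm.trans_le (eGradNormSq_fourierTruncate_le_norm K u)
      have h2 : band u ≤ 4 * Real.pi ^ 2 * (K : ℝ) ^ 2 * ‖u‖ ^ 2 :=
        (ENNReal.ofReal_le_ofReal_iff (by positivity)).1 h1
      exact h2.trans (mul_le_mul_of_nonneg_left (pow_le_pow_left₀ (norm_nonneg u) hu 2) (by positivity))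
    -- so `∫⁻ ‖∇P_K u‖² dρ = ofReal (∫ band dρ)` for every probability law `ρ` carried by the ball
    have hrepr : ∀ (ρ : Measure (Torus.energySpace (Fin 3))), IsProbabilityMeasure ρ →
        (∀ᵐ u ∂ρ, ‖u‖ ≤ R) →
        ∫⁻ u, Torus.eGradNormSq (Torus.fourierTruncate K
          (u.1 : UnitAddTorus (Fin 3) → EuclideanSpace ℝ (Fin 3))) ∂ρ = ENNReal.ofReal (∫ u, band u ∂ρ) := by
      intro ρ hρ hρb
      simp_rw [hband]
      refine (ofReal_integral_eq_lintegral_ofReal ?_ (Eventually.of_forall hnn)).symm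
      exact Integrable.of_bound hcont.aestronglyMeasurable (4 * Real.pi ^ 2 * (K : ℝ) ^ 2 * R ^ 2)
        (hρb.mono fun u hu => by rw [Real.norm_eq_abs]; exact hbd u hu)
    have hfun : (fun i => ∫⁻ u, Torus.eGradNormSq (Torus.fourierTruncate K
        (u.1 : UnitAddTorus (Fin 3) → EuclideanSpace ℝ (Fin 3))) ∂(μ (φ i))) =
        fun i => ENNReal.ofReal (∫ u, band u ∂(μ (φ i))) :=
      funext fun i => hrepr _ (hp (φ i)) (hb (φ i))
    rw [hfun, hrepr _ inferInstance hball]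
    exact (ENNReal.continuous_ofReal.tendsto _).comp (hballC band hcont _ hbd)
  -- pairings with `L²` fields
  have hPI : ∀ f : UnitAddTorus (Fin 3) → EuclideanSpace ℝ (Fin 3), MemLp f 2 volume →
      Tendsto (fun i => ∫ u, Torus.pairing u.1 f ∂(μ (φ i))) atTop
        (𝓝 (∫ u, Torus.pairing u.1 f ∂(Q : Measure (Torus.energySpace (Fin 3))))) :=
    fun f hf => hballC _ (Torus.continuous_pairing_coe hf) (|R| * ‖hf.toLp f‖) fun u hu =>
      (Torus.abs_pairing_coe_le hf u).trans
        (mul_le_mul_of_nonneg_right (hu.trans (le_abs_self R)) (norm_nonneg _))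
  exact ⟨φ, hφ, Q, inferInstance, hball, hBC, hLSC, hTE, hPI⟩

end Summit.AnomalousDissipation.AnomalousDissipation.Theorems.MomentParityResolvedDissipation.TightExtraction

end
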